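import Summits.ResolutionOfSingularities.ResolutionOfSingularities.Theorems.UniformComplexityCampaignW82TwistExponentCusp
import Literature.AlgebraicGeometry.Resolution.FundamentalLocus
import Literature.AlgebraicGeometry.Resolution.ComponentGluing
import Literature.AlgebraicGeometry.Morphisms.SteinFactorizationProofs
import Literature.AlgebraicGeometry.Resolution.RegularLocalRingsNormal
import Mathlib.AlgebraicGeometry.Morphisms.Proper
import HarnessLib

/-!
# [OURS · L1 W8.2] Rigidity: `y^q = (x^p − t)^N` has no proper birational model smooth over `K`

Cell `res-hironaka`, LADDER-RESOLUTION rung L (RESCUE), slot W8.2, door 2 (`UniformComplexity`, host item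
`PrimeModelTransfer` stmt-ResolutionOfSingularities-8933); prover res-L1-s82-pv-2 (gen 3). THESES-FREE module
(imports the sibling `…TwistExponentCusp`, the tree's `FundamentalLocus` (stalk maps over valuation-ring
points are isomorphisms), `ComponentGluing` (`IsBirational.irreducibleSpace`), `SteinFactorizationProofs`
(`isIntegrallyClosed_sections_of_stalk`), `RegularLocalRingsNormal`, Mathlib, `HarnessLib`).

[OURS · L1 W8.2] MAIN THEOREM `no_smooth_model_twistCurve`: for a field `K` of characteristic `p`, `t ∈ K`
with `X^p − t` irreducible (`t ∉ K^p`), a prime `q ≠ p` and `N ≥ 1` with `q ∤ N`, NO proper birational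
`π : Y ⟶ C_N = Spec K[x,y]/(y^q − (x^p − t)^N)` has `Y ⟶ Spec K` smooth. Proof, in tree terms: `Y` is
integral (reduced as smooth, irreducible as birational) and `π` is onto (proper + dominant), so some
`y' ↦ P_N = (y, x^p − t)`; on an affine neighbourhood `Spec R ∋ y'`, `R` is an integrally closed domain
(smooth ⇒ regular stalks ⇒ normal) into which `A_N` injects (dominance), so `w = y^b g^a` (`aq + bN = 1`;
`w^q = g`, `w^N = y`) lies in `R` and defines `Spec R ⟶ C_1` over `C_N`, dominant (injective: `A_1` is
integral over `A_N`), with `y' ↦ P_1` (the only point of `C_1` over `P_N`) and bijective stalk map at the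
generic point; since `𝒪_{C_1,P_1}` is a valuation ring, the stalk map at `y'` is an isomorphism
(`isIso_stalkMap_of_valuationRing_stalk`), so formal smoothness of `K → 𝒪_{Y,y'}` (Mathlib
`Scheme.Hom.smoothLocus`) passes to `K → 𝒪_{C_1,P_1}`: `P_1` lies in the open smooth locus of
`C_1 → Spec K`, contradicting `false_of_smooth_nhd_cuspPoint`. For `N = 1`: Kollár's regular curve
`y^q = x^p − t` has no smooth proper birational model over `K` (cf. res-L1-s82-pv-1's `e = 0` target over
`𝔽_p(t)`); for `N = p^e`: the `e`-th Frobenius twist of `y^q = x^{p^{e+1}} − t` has none — the input of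
the rung «no bounded Frobenius-twist exponent» (sibling `…TwistExponentUnbounded`).

HONEST FRAMING. OURS negative-side bookkeeping; NOT a statement of H. Hironaka's 2017 manuscript ([Hironaka2017]);
nothing here is attributed to its author. AI work, weaker than expert review.

## References (vocabulary and locators only)
* J. Kollár, *Lectures on Resolution of Singularities* (2007), 1.19. [Kollar2007]
* The Stacks Project, Tags 056S, 01KZ, 0AB1; O. Piltant (2013), §2 (behind `FundamentalLocus`). [StacksProject] [Piltant2013]
-/

noncomputable section

set_option linter.dupNamespace false -- mandated namespace of this single-conjunct summit

open Polynomial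
open scoped TensorProduct
open _root_.CategoryTheory _root_.CategoryTheory.Limits _root_.AlgebraicGeometry

namespace Summit.ResolutionOfSingularities.ResolutionOfSingularities.Theorems.CampaignW82.TwistExponent

section Rigidity
open Literature.AlgebraicGeometry.Resolution

variable (K : Type) [Field K] (p : ℕ) (t : K) (q : ℕ)

/-! ## The main theorem -/

/-- **RIGIDITY: the curve `C_N : y^q = (x^p − t)^N` (`t ∉ K^p`, `q ≠ p` prime, `N ≥ 1`, `q ∤ N`) has no
proper birational model smooth over `K`.** Proof: let `π : Y → C_N` be proper birational with `Y`
smooth over `K`; `Y` is integral and `π` is onto, so some `y' ∈ Y` maps to the point `P_N`; on an affine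
neighbourhood `Spec R ∋ y'`, `R` is an integrally closed domain (smooth ⇒ regular local rings ⇒ normal)
containing `A_N`, hence containing `w = y^b g^a` (`w^q = g`, `w^N = y`): this gives `Spec R → C_1` over
`C_N`, sending `y'` to `P_1` (the only point of `C_1` over `P_N`), dominant with isomorphic function
fields; as `𝒪_{C_1,P_1}` is a valuation ring the stalk map `𝒪_{C_1,P_1} → 𝒪_{Y,y'}` is an isomorphism
(`isIso_stalkMap_of_valuationRing_stalk`), so formal smoothness of `K → 𝒪_{Y,y'}` passes to
`K → 𝒪_{C_1,P_1}`: `P_1` lies in the (open) smooth locus of `C_1 → Spec K`, contradicting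
`false_of_smooth_nhd_cuspPoint`. [folklore] -/
theorem no_smooth_model_twistCurve [hp : Fact p.Prime] [CharP K p] [hq : Fact q.Prime] (hqp : q ≠ p)
    (ht : Irreducible (X ^ p - C t : K[X])) {N : ℕ} (hN : 0 < N) (hqN : q.Coprime N)
    (Y : Scheme.{0}) (π : Y ⟶ twistCurve K p t q N) [IsProper π] (hbir : IsBirational π)
    [hsm : Smooth (π ≫ twistCurveTo K p t q N)] : False := by
  classical
  have hq' := hq.out
  have hqN' : ¬ q ∣ N := (Nat.Prime.coprime_iff_not_dvd hq').mp hqN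
  have hq1 : ¬ q ∣ 1 := fun h => hq'.ne_one (Nat.dvd_one.mp h)
  haveI hA : IsDomain (TwistRing K p t q N) := isDomain_twistRing hqp hqN'
  haveI hB : IsDomain (TwistRing K p t q 1) := isDomain_twistRing hqp hq1
  haveI : IsReduced Y := isReduced_of_smooth (π ≫ twistCurveTo K p t q N)
  haveI : IrreducibleSpace Y := hbir.irreducibleSpace
  haveI : IsIntegral Y := isIntegral_of_irreducibleSpace_of_isReduced Y
  haveI : IsDominant π := hbir.isDominant
  -- a point `y'` of `Y` over `P_N`
  have hsurj : Function.Surjective π.base := by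
    rw [← Set.range_eq_univ, ← π.isClosedMap.isClosed_range.closure_eq]
    exact π.denseRange.closure_eq
  obtain ⟨y', hy'⟩ := hsurj (cuspPoint K p t q ht hN)
  -- an affine open neighbourhood `U = Spec R` of `y'`
  obtain ⟨_, ⟨U', hU, rfl⟩, hyU, -⟩ :=
    Y.isBasis_affineOpens.exists_subset_of_mem_open (Set.mem_univ y') isOpen_univ
  let U : Y.Opens := U'
  change IsAffineOpen U at hU
  change y' ∈ (U : Set Y) at hyU
  haveI : Nonempty U := ⟨⟨y', hyU⟩⟩
  let e : (U : Scheme.{0}) ≅ Spec Γ(Y, U) := hU.isoSpec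
  let πU : Spec Γ(Y, U) ⟶ twistCurve K p t q N := e.inv ≫ U.ι ≫ π
  let α : CommRingCat.of (TwistRing K p t q N) ⟶ Γ(Y, U) := Spec.preimage πU
  have hα : Spec.map α = πU := Spec.map_preimage πU
  let y'' : ↥(Spec Γ(Y, U)) := e.hom.base ⟨y', hyU⟩
  have hπU_y : πU.base y'' = cuspPoint K p t q ht hN := by
    change (e.hom ≫ e.inv ≫ U.ι ≫ π).base ⟨y', hyU⟩ = _
    rw [Iso.hom_inv_id_assoc]
    exact hy'
  have hαy : (y''.asIdeal).comap α.hom = QIdeal K p t q N := by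
    have h := congrArg PrimeSpectrum.asIdeal hπU_y
    rw [← hα] at h
    exact h
  -- `R = Γ(Y, U)` is an integrally closed domain and `α : A_N → R` is injective
  have hRic : IsIntegrallyClosed Γ(Y, U) :=
    Literature.AlgebraicGeometry.Morphisms.TowardsNormal.isIntegrallyClosed_sections_of_stalk hU
      (fun x => @isIntegrallyClosed_of_isRegularLocalRing _ _
        (isRegularLocalRing_stalk_of_smooth_of_field (π ≫ twistCurveTo K p t q N) x))
  haveI : IsDominant U.ι :=
    AlgebraicGeometry.Opens.isDominant_ι (U.2.dense ⟨y', hyU⟩)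
  haveI : IsDominant πU := inferInstance
  have hαinj : Function.Injective α.hom := by
    have hd : DenseRange (PrimeSpectrum.comap α.hom) := by
      have : DenseRange (Spec.map α).base := by rw [hα]; exact πU.denseRange
      exact this
    have hker := (PrimeSpectrum.denseRange_comap_iff_ker_le_nilRadical _).mp hd
    rw [nilradical_eq_zero, Ideal.zero_eq_bot, le_bot_iff] at hker
    exact (RingHom.injective_iff_ker_eq_bot _).mpr hker
  -- `w ∈ R` with `w^q = α(g)`, `w^N = α(y)`
  have hyg : (α.hom (yElt K p t q N)) ^ q = (α.hom (gElt K p t q N)) ^ N := by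
    rw [← map_pow, ← map_pow, yElt_pow_eq]
  have hg0 : α.hom (gElt K p t q N) ≠ 0 := fun h =>
    gElt_ne_zero K p t q N (hαinj (by rw [h, map_zero]))
  obtain ⟨w₀, hw₀q, hw₀N⟩ := exists_root_of_pow_eq_pow_of_isIntegrallyClosed hq'.pos hqN hyg hg0
  -- `β : A_1 → R`, `w ↦ w₀`, `x ↦ α(x)`, with `β ∘ ν♯ = α`
  let φ : MvPolynomial (Fin 2) K →+* Γ(Y, U) :=
    MvPolynomial.eval₂Hom (α.hom.comp (algebraMap K (TwistRing K p t q N))) ![w₀, α.hom (xElt K p t q N)]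
  have hφ : φ (twistPoly K p t q 1) = 0 := by
    simp only [φ, twistPoly, MvPolynomial.coe_eval₂Hom,
      MvPolynomial.eval₂_X, MvPolynomial.eval₂_C, Matrix.cons_val_zero, Matrix.cons_val_one,
      Matrix.cons_val_fin_one, pow_one, RingHom.comp_apply, hw₀q, gElt_eq, map_sub, map_pow]
    ring
  let β : TwistRing K p t q 1 →+* Γ(Y, U) :=
    Ideal.Quotient.lift (Ideal.span {twistPoly K p t q 1}) φ (fun a ha => by
      obtain ⟨c, rfl⟩ := Ideal.mem_span_singleton.mp ha
      rw [map_mul, hφ, zero_mul])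
  have hβν : β.comp (normMap K p t q N).toRingHom = α.hom := by
    refine Ideal.Quotient.ringHom_ext (MvPolynomial.ringHom_ext (fun a => ?_) (fun i => ?_))
    · change β (normMap K p t q N (Ideal.Quotient.mk _ (MvPolynomial.C a))) = α.hom (Ideal.Quotient.mk _ (MvPolynomial.C a))
      rw [normMap_mk]
      simp [β, φ, normSubst, MvPolynomial.algebraMap_eq]
      rfl
    · have hi : i = 0 ∨ i = 1 := by
        rcases i with ⟨_ | i, hi⟩
        · exact Or.inl rfl
        · right; ext; simp; omega
      rcases hi with rfl | rfl
      · change β (normMap K p t q N (yElt K p t q N)) = α.hom (yElt K p t q N)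
        rw [normMap_yElt, map_pow]
        change (φ (MvPolynomial.X 0)) ^ N = _
        simp [φ, hw₀N]
      · change β (normMap K p t q N (xElt K p t q N)) = α.hom (xElt K p t q N)
        rw [normMap_xElt]
        change φ (MvPolynomial.X 1) = _
        simp [φ]
  -- the morphism `ν_U : Spec R → C_1` over `C_N`
  let νU : Spec Γ(Y, U) ⟶ twistCurve K p t q 1 := Spec.map (CommRingCat.ofHom β)
  have hνUν : νU ≫ normMor K p t q N = πU := by
    rw [← hα, ← Spec.map_comp]
    congr 1
    ext1
    exact hβν
  -- `β` is injective (`A_1` is integral over `A_N`, `α` is injective), so `ν_U` is dominant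
  have hβinj : Function.Injective β := by
    letI : Algebra (TwistRing K p t q N) (TwistRing K p t q 1) := (normMap K p t q N).toRingHom.toAlgebra
    haveI : Algebra.IsIntegral (TwistRing K p t q N) (TwistRing K p t q 1) :=
      ⟨isIntegral_normMap K p t q N⟩
    haveI : (RingHom.ker β).IsPrime := RingHom.ker_isPrime β
    have hker : (RingHom.ker β).comap (algebraMap (TwistRing K p t q N) (TwistRing K p t q 1)) = ⊥ := by
      rw [RingHom.comap_ker]
      change RingHom.ker (β.comp (normMap K p t q N).toRingHom) = ⊥
      rw [hβν]
      exact (RingHom.injective_iff_ker_eq_bot _).mp hαinj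
    exact (RingHom.injective_iff_ker_eq_bot β).mpr (Ideal.eq_bot_of_comap_eq_bot hker)
  haveI : IsDominant νU := ⟨by
    change DenseRange (PrimeSpectrum.comap β)
    rw [PrimeSpectrum.denseRange_comap_iff_ker_le_nilRadical,
      (RingHom.injective_iff_ker_eq_bot β).mp hβinj]
    exact bot_le⟩
  -- `ν_U(y'') = P_1`
  have hνU_y : νU.base y'' = cuspPoint K p t q ht Nat.one_pos := by
    apply PrimeSpectrum.ext
    change (y''.asIdeal).comap β = QIdeal K p t q 1
    haveI : ((y''.asIdeal).comap β).IsPrime := Ideal.comap_isPrime β _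
    refine eq_QIdeal_one_of_comap_normMap K p t q ht (N := N) _ ?_
    rw [Ideal.comap_comap, hβν]
    exact hαy
  -- the stalk map of `ν_U` at `y''` is an isomorphism
  have hη : IsIso (νU.stalkMap (genericPoint ↥(Spec Γ(Y, U)))) := by
    set η := genericPoint ↥(Spec Γ(Y, U)) with hηdef
    -- the stalk map of `π_U = ν_U ≫ ν` at `η` is an isomorphism (`π` is birational)
    have hpt : U.ι.base (e.inv.base η) = genericPoint Y := by
      rw [← Scheme.Hom.comp_apply]
      exact genericPoint_eq_of_isDominant (e.inv ≫ U.ι)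
    have hπη : IsIso (π.stalkMap (U.ι.base (e.inv.base η))) := by
      rw [hpt]; exact hbir.isIso_stalkMap_genericPoint
    have h1 : IsIso ((νU ≫ normMor K p t q N).stalkMap η) := by
      rw [hνUν]
      change IsIso ((e.inv ≫ U.ι ≫ π).stalkMap η)
      rw [Scheme.Hom.stalkMap_comp, Scheme.Hom.stalkMap_comp]
      change IsIso ((π.stalkMap (U.ι.base (e.inv.base η)) ≫ U.ι.stalkMap (e.inv.base η)) ≫
        e.inv.stalkMap η)
      infer_instance
    rw [Scheme.Hom.stalkMap_comp] at h1
    have hsurjη : Function.Surjective (νU.stalkMap η).hom := by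
      have hb := ((ConcreteCategory.isIso_iff_bijective _).mp h1).2
      have hb' : Function.Surjective
          ((νU.stalkMap η).hom ∘ ((normMor K p t q N).stalkMap (νU.base η)).hom) := hb
      exact Function.Surjective.of_comp hb'
    have hinjη : Function.Injective (νU.stalkMap η).hom := by
      have hgen : νU.base η = genericPoint ↥(twistCurve K p t q 1) := genericPoint_eq_of_isDominant νU
      have hF : IsField ((twistCurve K p t q 1).presheaf.stalk (νU.base η)) := by
        rw [hgen]
        exact @Field.toIsField _ (inferInstance : Field (twistCurve K p t q 1).functionField)
      rw [injective_iff_map_eq_zero]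
      intro a ha
      by_contra hne
      obtain ⟨b, hb⟩ := hF.mul_inv_cancel hne
      have h' := congrArg (νU.stalkMap η).hom hb
      rw [map_mul, ha, zero_mul, map_one] at h'
      exact zero_ne_one h'
    exact (ConcreteCategory.isIso_iff_bijective _).mpr ⟨hinjη, hsurjη⟩
  have hv : ValuationRing ((twistCurve K p t q 1).presheaf.stalk (νU.base y'')) := by
    rw [hνU_y]
    exact valuationRing_stalk_cuspPoint K p t q hqp ht
  haveI hstalk : IsIso (νU.stalkMap y'') := isIso_stalkMap_of_valuationRing_stalk νU hη y'' hv
  -- formal smoothness passes from `𝒪_{Y,y'}` to `𝒪_{C_1,P_1}`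
  have hcomp : πU ≫ twistCurveTo K p t q N = νU ≫ twistCurveTo K p t q 1 := by
    rw [← hνUν, Category.assoc, normMor_comp_twistCurveTo]
  haveI hsmU : Smooth (νU ≫ twistCurveTo K p t q 1) := by
    rw [← hcomp]
    simp only [πU, Category.assoc]
    infer_instance
  have hfs : ((νU ≫ twistCurveTo K p t q 1).stalkMap y'').hom.FormallySmooth :=
    (Scheme.Hom.mem_smoothLocus (f := νU ≫ twistCurveTo K p t q 1)).mp
      (by rw [Scheme.Hom.smoothLocus_eq_top]; trivial)
  rw [Scheme.Hom.stalkMap_comp] at hfs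
  have hfs' : ((twistCurveTo K p t q 1).stalkMap (νU.base y'')).hom.FormallySmooth :=
    (RingHom.FormallySmooth.respectsIso.cancel_right_isIso _ _).mp hfs
  rw [hνU_y] at hfs'
  -- so `P_1` lies in the smooth locus `V`, an open smooth over `K`: contradiction
  set V := (twistCurveTo K p t q 1).smoothLocus with hV
  have hQV : cuspPoint K p t q ht Nat.one_pos ∈ V := hfs'
  haveI : Smooth (V.ι ≫ twistCurveTo K p t q 1) := by
    rw [← Scheme.Hom.smoothLocus_eq_top_iff, ← Scheme.Hom.preimage_smoothLocus_eq]
    exact Scheme.Opens.ι_preimage_self V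
  exact false_of_smooth_nhd_cuspPoint K p t q ht V hQV

end Rigidity

end Summit.ResolutionOfSingularities.ResolutionOfSingularities.Theorems.CampaignW82.TwistExponent

end
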